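import Literature.NumberTheory.Automorphic.UnitaryGroupArthurTraceTwoSocketsClosed
import Literature.NumberTheory.Automorphic.UnitaryGroupCentralSocketClosedCMTwo
import HarnessLib

/-!
# `J(f)` for the quasi-split `U(J₂)` of a CM field — SPELLED: every class term written out, ONE Haar scalar bound before `f`
# (the `N = 2` twin of ★ `UnitaryGroupArthurTraceSpelledCM`)
(Rogawski, *Automorphic Representations of Unitary Groups in Three Variables* (1990), §2.3 p. 14 «`J(f) = Σ_𝔬 J_𝔬(f)`», §6.1 (6.1.3)
(regular hyperbolic classes), Prop. 7.3.1 (central ∕ unipotent classes) and p. 98 «Let `G = U(3)`, `U(2)`, or `U(2) × U(1)`»;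
Arthur, *A trace formula for reductive groups I*, Duke Math. J. 45 (1978), §8.)

Topic `NumberTheory/Automorphic`; namespace `Literature.NumberTheory.Automorphic.UnitaryGroup`. THEOREMS ONLY over accepted tree
modules (no definition, no named fact, no instance, no notation, no `sorry`). H-SIDE copy of LAWS 1–5 (`H = U(Φ₂) × U(Φ₁)`, rank-one
factor `U(J₂)`) of the line `Cruxes/H413/Lines/F0_T1InnerFormTraceIdentity.lean` (cell hodgecm-mathlib, crux H413; H-desk OPTIONAL
row «`ArthurTraceSpelledCMTwo`», dealt 16:03Z): the parts-free two-sockets skeleton ★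
`arthurTrace_eq_orbital_add_central_add_hyperbolic_of_closers_cm_two` (`UnitaryGroupArthurTraceTwoSocketsClosed`, F0P3a-p02) with
`closerC :=` the CONSTANTS-FIRST central closer ★ `exists_const_closerC_central_cm_two'` (`UnitaryGroupCentralSocketClosedCMTwo` ED. 2;
Prop. 7.3.1 spelled, `∃ 𝔠 > 0` BEFORE `f`) — so that, compared with ★ `arthurTrace_eq_orbital_add_central_add_hyperbolic_explicit_cm_two`
(`UnitaryGroupArthurTraceExplicitCMTwo`), the only existential left, the positive scalar `𝔠 = Cg · μ_N(Ω) · Cp` of the central block,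
is bound BEFORE the test function (there is no singular block in rank one, so no further constant: this IS the `U(J₂)` analogue of ★
`arthurTrace_eq_spelled_cm`'s «ONE Haar scalar»). Binders = the explicit edition's minus `f hf`, which moved behind the constant;
statement generated mechanically from F0P3a-p02's text; proof = the skeleton applied to `closerC hf` + `cases`.

## References

* J. D. Rogawski, *Automorphic Representations of Unitary Groups in Three Variables*, Ann. of Math. Stud. 123 (1990), §2.3 (p. 14),
  §6.1 (pp. 79–80), §7.3 (pp. 97–98) [Rogawski1990].
* J. Arthur, *A trace formula for reductive groups I*, Duke Math. J. 45 (1978), §8 [Arthur1978TraceFormulaI].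
-/

set_option autoImplicit false

noncomputable section

open MeasureTheory Measure NumberField IsDedekindDomain Set Matrix Polynomial
open Literature.MeasureTheory.Group
open Literature.NumberTheory.Automorphic.Meyer
open Literature.NumberTheory.GaloisRepresentations (quadraticArtinIndicator)
open scoped NNReal ENNReal Classical MatrixGroups

namespace Literature.NumberTheory.Automorphic

namespace UnitaryGroup

/-- **`J(f)` ON THE QUASI-SPLIT `U(J₂)` OF A CM FIELD — SPELLED: the two Borel sockets closed, every class term written out, the
ONE Haar scalar `𝔠 > 0` bound BEFORE the test function** [Rogawski1990, §2.3 (p. 14), §6.1 (6.1.3), Prop. 7.3.1 (p. 97) «Let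
`G = U(3)`, `U(2)`, or `U(2) × U(1)`»]. For the Haar ∕ covering ∕ quadratic data of `U(J₂)` over the CM field `L` there is ONE `𝔠 > 0`
such that for EVERY test function `f`, Arthur's `J(f)` equals the elliptic orbital sum (★ `arthurTrace_eq_sum_orbital_add_sum_central_add_sum_hyperbolic_cm_two`)
plus `Σ_{central i} (μ(X)·f(ζ_i·1) + c_μ·𝔠·𝔟₀(φ_{ζ_i}))` [Prop. 7.3.1 (a)–(d), `ζ_i = zrep i ∈ L¹`] plus
`Σ_{hyperbolic i} −(c_μ·C_w·J^v(hyrep i, f))` [(6.1.3)] — the `N = 2` twin of ★ `arthurTrace_eq_spelled_cm` (no singular block in rank one).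
Statement = ★ `arthurTrace_eq_orbital_add_central_add_hyperbolic_explicit_cm_two`'s (F0P3a-p02) with `f hf` moved behind the constant;
proof = the parts-free skeleton ★ `arthurTrace_eq_orbital_add_central_add_hyperbolic_of_closers_cm_two` with `closerC :=` the
constants-first central closer ★ `exists_const_closerC_central_cm_two'`. [cite: Rogawski1990, §2.3 (p. 14), §6.1 (6.1.3),
Prop. 7.3.1 (p. 97)] [cite: Arthur1978TraceFormulaI, §8] -/
theorem arthurTrace_eq_spelled_cm_two (L : Type) [Field L] [NumberField L] [IsCMField L]
    (hij : (((0 : Fin 2) : Fin 2) : ℕ) + 1 = (((1 : Fin 2) : Fin 2) : ℕ)) (hN : 2 = 2 * (((0 : Fin 2) : Fin 2) : ℕ) + 2)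
    [instMA : MeasurableSpace (quasiSplit (↥(maximalRealSubfield L)) L (IsCMField.complexConj L) 2).Adelic] [instBA : BorelSpace (quasiSplit (↥(maximalRealSubfield L)) L (IsCMField.complexConj L) 2).Adelic]
    (ν : Measure (quasiSplit (↥(maximalRealSubfield L)) L (IsCMField.complexConj L) 2).Adelic) [instν : IsHaarMeasure ν]
    (μ : Measure (quasiSplit (↥(maximalRealSubfield L)) L (IsCMField.complexConj L) 2).automorphicQuotient)
    [instμ : (quasiSplit (↥(maximalRealSubfield L)) L (IsCMField.complexConj L) 2).IsAutomorphicMeasure μ]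
    [instMU : MeasurableSpace (adelicUnipotent (↥(maximalRealSubfield L)) L (IsCMField.complexConj L) 2)]
    [instBU : BorelSpace (adelicUnipotent (↥(maximalRealSubfield L)) L (IsCMField.complexConj L) 2)]
    [instMAF : MeasurableSpace (AdeleRing (𝓞 (↥(maximalRealSubfield L))) (↥(maximalRealSubfield L)))]
    [instBAF : BorelSpace (AdeleRing (𝓞 (↥(maximalRealSubfield L))) (↥(maximalRealSubfield L)))]
    [instMI : MeasurableSpace (GaloisRepresentations.ideleGroup (↥(maximalRealSubfield L)))]
    [instBI : BorelSpace (GaloisRepresentations.ideleGroup (↥(maximalRealSubfield L)))]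
    [instMAL : MeasurableSpace (AdeleRing (𝓞 L) L)] [instBAL : BorelSpace (AdeleRing (𝓞 L) L)]
    [instMQ : ∀ γ : (quasiSplit (↥(maximalRealSubfield L)) L (IsCMField.complexConj L) 2).Adelic,
      MeasurableSpace ((quasiSplit (↥(maximalRealSubfield L)) L (IsCMField.complexConj L) 2).Adelic ⧸
        Subgroup.centralizer ({γ} : Set (quasiSplit (↥(maximalRealSubfield L)) L (IsCMField.complexConj L) 2).Adelic))]
    [instBQ : ∀ γ : (quasiSplit (↥(maximalRealSubfield L)) L (IsCMField.complexConj L) 2).Adelic,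
      BorelSpace ((quasiSplit (↥(maximalRealSubfield L)) L (IsCMField.complexConj L) 2).Adelic ⧸
        Subgroup.centralizer ({γ} : Set (quasiSplit (↥(maximalRealSubfield L)) L (IsCMField.complexConj L) 2).Adelic))]
    [instMS : ∀ γ : (quasiSplit (↥(maximalRealSubfield L)) L (IsCMField.complexConj L) 2).Adelic,
      MeasurableSpace (↥(Subgroup.centralizer ({γ} : Set (quasiSplit (↥(maximalRealSubfield L)) L (IsCMField.complexConj L) 2).Adelic)) ⧸
        ((quasiSplit (↥(maximalRealSubfield L)) L (IsCMField.complexConj L) 2).quotientSubgroup ⊓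
          Subgroup.centralizer ({γ} : Set (quasiSplit (↥(maximalRealSubfield L)) L (IsCMField.complexConj L) 2).Adelic)).subgroupOf
          (Subgroup.centralizer ({γ} : Set (quasiSplit (↥(maximalRealSubfield L)) L (IsCMField.complexConj L) 2).Adelic)))]
    [instBS : ∀ γ : (quasiSplit (↥(maximalRealSubfield L)) L (IsCMField.complexConj L) 2).Adelic,
      BorelSpace (↥(Subgroup.centralizer ({γ} : Set (quasiSplit (↥(maximalRealSubfield L)) L (IsCMField.complexConj L) 2).Adelic)) ⧸
        ((quasiSplit (↥(maximalRealSubfield L)) L (IsCMField.complexConj L) 2).quotientSubgroup ⊓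
          Subgroup.centralizer ({γ} : Set (quasiSplit (↥(maximalRealSubfield L)) L (IsCMField.complexConj L) 2).Adelic)).subgroupOf
          (Subgroup.centralizer ({γ} : Set (quasiSplit (↥(maximalRealSubfield L)) L (IsCMField.complexConj L) 2).Adelic)))]
    (ν₀ : Measure (adelicUnipotent (↥(maximalRealSubfield L)) L (IsCMField.complexConj L) 2)) [instν₀ : ν₀.IsHaarMeasure]
    (𝓕 : Set (adelicUnipotent (↥(maximalRealSubfield L)) L (IsCMField.complexConj L) 2))
    (h𝓕 : IsFundamentalDomain (rationalUnipotent (↥(maximalRealSubfield L)) L (IsCMField.complexConj L) 2) 𝓕 ν₀)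
    (rep : ConjClasses ↥(quasiSplit (↥(maximalRealSubfield L)) L (IsCMField.complexConj L) 2).arithmeticSubgroup → ↥(quasiSplit (↥(maximalRealSubfield L)) L (IsCMField.complexConj L) 2).arithmeticSubgroup)
    (hrep : ∀ s, ConjClasses.mk (rep s) = s)
    (νC : ∀ s : ConjClasses ↥(quasiSplit (↥(maximalRealSubfield L)) L (IsCMField.complexConj L) 2).arithmeticSubgroup,
      Measure ↥(Subgroup.centralizer ({((rep s : ↥(quasiSplit (↥(maximalRealSubfield L)) L (IsCMField.complexConj L) 2).arithmeticSubgroup) : (quasiSplit (↥(maximalRealSubfield L)) L (IsCMField.complexConj L) 2).Adelic)} : Set (quasiSplit (↥(maximalRealSubfield L)) L (IsCMField.complexConj L) 2).Adelic)))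
    [instνC : ∀ s, IsHaarMeasure (νC s)]
    [MeasurableSpace ((quasiSplit (↥(maximalRealSubfield L)) L (IsCMField.complexConj L) 2).Adelic ⧸
      torusAdelic (↥(maximalRealSubfield L)) L (IsCMField.complexConj L) 2)]
    [BorelSpace ((quasiSplit (↥(maximalRealSubfield L)) L (IsCMField.complexConj L) 2).Adelic ⧸
      torusAdelic (↥(maximalRealSubfield L)) L (IsCMField.complexConj L) 2)]
    (ρ : Measure ↥(torusAdelic (↥(maximalRealSubfield L)) L (IsCMField.complexConj L) 2)) [ρ.IsHaarMeasure] [ρ.IsInvInvariant]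
    {w : (quasiSplit (↥(maximalRealSubfield L)) L (IsCMField.complexConj L) 2).Rational}
    (hw : ((w.1 : GL (Fin 2) L) : Matrix (Fin 2) (Fin 2) L) = !![(0 : L), 1; 1, 0])
    {Cw : ℝ≥0∞} (hC : Cw ≠ ⊤)
    (hwin : ∀ β' : torusInBorel (↥(maximalRealSubfield L)) L (IsCMField.complexConj L) 2 → ℝ≥0∞,
        IsCoveringWeight ((rationalBorel (↥(maximalRealSubfield L)) L (IsCMField.complexConj L) 2).subgroupOf
          (torusInBorel (↥(maximalRealSubfield L)) L (IsCMField.complexConj L) 2)) β' →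
        ∀ A B : ℝ≥0, 0 < A → A ≤ B →
          ∫⁻ s : torusInBorel (↥(maximalRealSubfield L)) L (IsCMField.complexConj L) 2, β' s *
            {s : torusInBorel (↥(maximalRealSubfield L)) L (IsCMField.complexConj L) 2 |
              A < borelHeight (((s : torusInBorel (↥(maximalRealSubfield L)) L (IsCMField.complexConj L) 2) :
                borelAdelic (↥(maximalRealSubfield L)) L (IsCMField.complexConj L) 2) :
                (quasiSplit (↥(maximalRealSubfield L)) L (IsCMField.complexConj L) 2).Adelic) ∧
              borelHeight (((s : torusInBorel (↥(maximalRealSubfield L)) L (IsCMField.complexConj L) 2) :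
                borelAdelic (↥(maximalRealSubfield L)) L (IsCMField.complexConj L) 2) :
                (quasiSplit (↥(maximalRealSubfield L)) L (IsCMField.complexConj L) 2).Adelic) ≤ B}.indicator 1 s
            ∂(Measure.map (⇑(Subgroup.subgroupOfEquivOfLe
              (torusAdelic_le_borelAdelic (F := ↥(maximalRealSubfield L)) (E := L) (c := IsCMField.complexConj L) (N := 2))).symm) ρ :
                Measure (torusInBorel (↥(maximalRealSubfield L)) L (IsCMField.complexConj L) 2)) =
            Cw * ENNReal.ofReal (Real.log (B : ℝ) - Real.log (A : ℝ)))
    {β : (quasiSplit (↥(maximalRealSubfield L)) L (IsCMField.complexConj L) 2).Adelic → ℝ≥0∞}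
    (hβ : IsCoveringWeight ((arithmeticBorel (↥(maximalRealSubfield L)) L (IsCMField.complexConj L) 2).map (quasiSplit (↥(maximalRealSubfield L)) L (IsCMField.complexConj L) 2).arithmeticSubgroup.subtype) β)
    (μB : Measure (borelAdelic (↥(maximalRealSubfield L)) L (IsCMField.complexConj L) 2)) [instμB : μB.IsHaarMeasure]
    (μK : Measure ((standardMaximalCompactGL 2 L).comap
      (adelicVal (↥(maximalRealSubfield L)) L (IsCMField.complexConj L) 2 ((StdForm.antidiagonal 2).over L)) : Subgroup (quasiSplit (↥(maximalRealSubfield L)) L (IsCMField.complexConj L) 2).Adelic))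
    [instμK : μK.IsHaarMeasure]
    (μT : Measure (torusInBorel (↥(maximalRealSubfield L)) L (IsCMField.complexConj L) 2)) [instμT : μT.IsHaarMeasure]
    (μN : Measure (unipotentInBorel (↥(maximalRealSubfield L)) L (IsCMField.complexConj L) 2)) [instμN : μN.IsHaarMeasure]
    {Ω : Set (unipotentInBorel (↥(maximalRealSubfield L)) L (IsCMField.complexConj L) 2)} (hΩ : MeasurableSet Ω)
    (hΩu : ∀ n : unipotentInBorel (↥(maximalRealSubfield L)) L (IsCMField.complexConj L) 2,
      ∃! γ : (((quasiSplit (↥(maximalRealSubfield L)) L (IsCMField.complexConj L) 2).arithmeticSubgroup).subgroupOf (borelAdelic (↥(maximalRealSubfield L)) L (IsCMField.complexConj L) 2)).subgroupOf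
        (unipotentInBorel (↥(maximalRealSubfield L)) L (IsCMField.complexConj L) 2), γ • n ∈ Ω)
    {wT : torusInBorel (↥(maximalRealSubfield L)) L (IsCMField.complexConj L) 2 → ℝ≥0∞}
    (hwT : IsCoveringWeight ((((quasiSplit (↥(maximalRealSubfield L)) L (IsCMField.complexConj L) 2).arithmeticSubgroup).subgroupOf (borelAdelic (↥(maximalRealSubfield L)) L (IsCMField.complexConj L) 2)).subgroupOf
      (torusInBorel (↥(maximalRealSubfield L)) L (IsCMField.complexConj L) 2)) wT)
    {δ : L} (hcδ : (IsCMField.complexConj L) δ = -δ) (hδ : δ ≠ 0) (θ₀ : 𝓞 (↥(maximalRealSubfield L))) (hθ : θ₀ ≠ 0)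
    (hd : δ * δ = algebraMap (↥(maximalRealSubfield L)) L (θ₀ : (↥(maximalRealSubfield L))))
    (μA : Measure (AdeleRing (𝓞 (↥(maximalRealSubfield L))) (↥(maximalRealSubfield L)))) [instμA : μA.IsAddHaarMeasure]
    (νF : Measure (GaloisRepresentations.ideleGroup (↥(maximalRealSubfield L)))) [instνF : νF.IsHaarMeasure]
    {𝓕F : Set (GaloisRepresentations.ideleGroup (↥(maximalRealSubfield L)))} (h𝓕F : IsIdeleClassDomain (↥(maximalRealSubfield L)) 𝓕F) :
    haveI := t2Space_quasiSplitAdelic (F := ↥(maximalRealSubfield L)) (E := L) (c := IsCMField.complexConj L) (N := 2)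
    haveI := locallyCompactSpace_quasiSplitAdelic (F := ↥(maximalRealSubfield L)) (E := L) (c := IsCMField.complexConj L) (N := 2)
    haveI := secondCountableTopology_quasiSplitAdelic (F := ↥(maximalRealSubfield L)) (E := L) (c := IsCMField.complexConj L) (N := 2)
    haveI : IsClosed (((quasiSplit (↥(maximalRealSubfield L)) L (IsCMField.complexConj L) 2).quotientSubgroup : Set (quasiSplit (↥(maximalRealSubfield L)) L (IsCMField.complexConj L) 2).Adelic)) :=
      isClosed_quotientSubgroup_quasiSplit
    haveI : ∀ γ : (quasiSplit (↥(maximalRealSubfield L)) L (IsCMField.complexConj L) 2).Adelic, IsClosed ((Subgroup.centralizer ({γ} : Set (quasiSplit (↥(maximalRealSubfield L)) L (IsCMField.complexConj L) 2).Adelic) :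
        Subgroup (quasiSplit (↥(maximalRealSubfield L)) L (IsCMField.complexConj L) 2).Adelic) : Set (quasiSplit (↥(maximalRealSubfield L)) L (IsCMField.complexConj L) 2).Adelic) := isClosed_centralizer_quasiSplit
    haveI : ∀ γ : (quasiSplit (↥(maximalRealSubfield L)) L (IsCMField.complexConj L) 2).Adelic, (count : Measure ↥(((quasiSplit (↥(maximalRealSubfield L)) L (IsCMField.complexConj L) 2).quotientSubgroup ⊓
        Subgroup.centralizer ({γ} : Set (quasiSplit (↥(maximalRealSubfield L)) L (IsCMField.complexConj L) 2).Adelic)).subgroupOf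
          (Subgroup.centralizer ({γ} : Set (quasiSplit (↥(maximalRealSubfield L)) L (IsCMField.complexConj L) 2).Adelic)))).IsHaarMeasure :=
      isHaarMeasure_count_inf_centralizer_subgroupOf_quasiSplit
    haveI : (count : Measure (quasiSplit (↥(maximalRealSubfield L)) L (IsCMField.complexConj L) 2).quotientSubgroup).IsHaarMeasure :=
      isHaarMeasure_count_quotientSubgroup_quasiSplit
    haveI : ν.IsMulRightInvariant := isMulRightInvariant_quasiSplit_cm_two L ν
    letI := AdelicGroupData.measurableSpaceQuotientForm (quasiSplit (↥(maximalRealSubfield L)) L (IsCMField.complexConj L) 2)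
    haveI := AdelicGroupData.borelSpaceQuotientForm (quasiSplit (↥(maximalRealSubfield L)) L (IsCMField.complexConj L) 2)
    haveI := AdelicGroupData.smulInvariantMeasureQuotientForm (quasiSplit (↥(maximalRealSubfield L)) L (IsCMField.complexConj L) 2) μ
    haveI := AdelicGroupData.isFiniteMeasureOnCompactsQuotientForm (quasiSplit (↥(maximalRealSubfield L)) L (IsCMField.complexConj L) 2) μ
    haveI := t2Space_adeleRing_of_numberField L
    haveI := locallyCompactSpace_adeleRing' L
    haveI := secondCountableTopology_adeleRing L
    ∃ 𝔠 : ℝ, 0 < 𝔠 ∧ ∀ (f : (quasiSplit (↥(maximalRealSubfield L)) L (IsCMField.complexConj L) 2).Adelic → ℂ)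
      (hf : IsQuasiSplitTest (↥(maximalRealSubfield L)) L (IsCMField.complexConj L) 2 f),
      ∃ (zrep : (AdeleRing (𝓞 L) L)[X] × Bool → ratOne (↥(maximalRealSubfield L)) L (IsCMField.complexConj L))
      (hyrep : (AdeleRing (𝓞 L) L)[X] × Bool → (quasiSplit (↥(maximalRealSubfield L)) L (IsCMField.complexConj L) 2).Rational),
      ∀ T : ℝ≥0, arthurTrace μ ν₀ 𝓕 f =
        (∑ i ∈ (((finite_setOf_borelRefine_charpoly_of_isCompact (F := ↥(maximalRealSubfield L)) (E := L) (c := IsCMField.complexConj L) (N := 2)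
          hf.hasCompactSupport'.isCompact).toFinset).filter (fun i => ∀ β : ↥(arithmeticBorel (↥(maximalRealSubfield L)) L (IsCMField.complexConj L) 2),
            (((adelicVal (↥(maximalRealSubfield L)) L (IsCMField.complexConj L) 2 _ ((β : ↥(quasiSplit (↥(maximalRealSubfield L)) L (IsCMField.complexConj L) 2).arithmeticSubgroup) : (quasiSplit (↥(maximalRealSubfield L)) L (IsCMField.complexConj L) 2).Adelic) :
                GL (Fin 2) (AdeleRing (𝓞 L) L)) : Matrix (Fin 2) (Fin 2) (AdeleRing (𝓞 L) L)).charpoly,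
              decide (∃ δ : ↥(quasiSplit (↥(maximalRealSubfield L)) L (IsCMField.complexConj L) 2).arithmeticSubgroup, δ * (β : ↥(quasiSplit (↥(maximalRealSubfield L)) L (IsCMField.complexConj L) 2).arithmeticSubgroup) * δ⁻¹ ∈ arithmeticBorel (↥(maximalRealSubfield L)) L (IsCMField.complexConj L) 2)) ≠ i)).attach,
          ((unfoldingConstant (quasiSplit (↥(maximalRealSubfield L)) L (IsCMField.complexConj L) 2).quotientSubgroup
              (count : Measure (quasiSplit (↥(maximalRealSubfield L)) L (IsCMField.complexConj L) 2).quotientSubgroup) μ ν : ℝ) : ℂ) *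
            ∑' s : {s : ConjClasses ↥(quasiSplit (↥(maximalRealSubfield L)) L (IsCMField.complexConj L) 2).arithmeticSubgroup //
                (((adelicVal (↥(maximalRealSubfield L)) L (IsCMField.complexConj L) 2 _ ((rep s : ↥(quasiSplit (↥(maximalRealSubfield L)) L (IsCMField.complexConj L) 2).arithmeticSubgroup) : (quasiSplit (↥(maximalRealSubfield L)) L (IsCMField.complexConj L) 2).Adelic) :
                GL (Fin 2) (AdeleRing (𝓞 L) L)) : Matrix (Fin 2) (Fin 2) (AdeleRing (𝓞 L) L)).charpoly,
              decide (∃ δ : ↥(quasiSplit (↥(maximalRealSubfield L)) L (IsCMField.complexConj L) 2).arithmeticSubgroup, δ * (rep s : ↥(quasiSplit (↥(maximalRealSubfield L)) L (IsCMField.complexConj L) 2).arithmeticSubgroup) * δ⁻¹ ∈ arithmeticBorel (↥(maximalRealSubfield L)) L (IsCMField.complexConj L) 2)) = i.1},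
              (haveI : (νC s.1).IsMulRightInvariant :=
                  isMulRightInvariant_centralizer_of_forall_cl_ne_two
                    (isConjInvariant_borelRefine isConjInvariant_charpoly_adelicVal) (Finset.mem_filter.1 i.2).2 s.2 (νC s.1);
                haveI : (νC s.1).IsInvInvariant :=
                  isInvInvariant_centralizer_of_forall_cl_ne_two
                    (isConjInvariant_borelRefine isConjInvariant_charpoly_adelicVal) (Finset.mem_filter.1 i.2).2 s.2 (νC s.1);
                ((quotientMeasure (((quasiSplit (↥(maximalRealSubfield L)) L (IsCMField.complexConj L) 2).quotientSubgroup ⊓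
                    Subgroup.centralizer ({((rep s.1 : ↥(quasiSplit (↥(maximalRealSubfield L)) L (IsCMField.complexConj L) 2).arithmeticSubgroup) : (quasiSplit (↥(maximalRealSubfield L)) L (IsCMField.complexConj L) 2).Adelic)} : Set (quasiSplit (↥(maximalRealSubfield L)) L (IsCMField.complexConj L) 2).Adelic)).subgroupOf
                    (Subgroup.centralizer ({((rep s.1 : ↥(quasiSplit (↥(maximalRealSubfield L)) L (IsCMField.complexConj L) 2).arithmeticSubgroup) : (quasiSplit (↥(maximalRealSubfield L)) L (IsCMField.complexConj L) 2).Adelic)} : Set (quasiSplit (↥(maximalRealSubfield L)) L (IsCMField.complexConj L) 2).Adelic)))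
                    count (isClosed_inf_centralizer_subgroupOf_quasiSplit _) (νC s.1) Set.univ).toReal : ℂ) *
                  orbitalIntegral ((rep s.1 : ↥(quasiSplit (↥(maximalRealSubfield L)) L (IsCMField.complexConj L) 2).arithmeticSubgroup) : (quasiSplit (↥(maximalRealSubfield L)) L (IsCMField.complexConj L) 2).Adelic) f
                    (quotientMeasure (Subgroup.centralizer ({((rep s.1 : ↥(quasiSplit (↥(maximalRealSubfield L)) L (IsCMField.complexConj L) 2).arithmeticSubgroup) : (quasiSplit (↥(maximalRealSubfield L)) L (IsCMField.complexConj L) 2).Adelic)} : Set (quasiSplit (↥(maximalRealSubfield L)) L (IsCMField.complexConj L) 2).Adelic)) (νC s.1)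
                      (isClosed_centralizer_quasiSplit _) ν))) +
        ((∑ i ∈ ((finite_setOf_borelRefine_charpoly_of_isCompact (F := ↥(maximalRealSubfield L)) (E := L) (c := IsCMField.complexConj L) (N := 2)
          hf.hasCompactSupport'.isCompact).toFinset).filter (fun i : (AdeleRing (𝓞 L) L)[X] × Bool => i.2 = true ∧
            ∃ z : Lˣ, (IsCMField.complexConj L) (z : L) * (z : L) = 1 ∧
              i.1 = ((X - C (z : L)) ^ 2).map (algebraMap L (AdeleRing (𝓞 L) L))),
            ((μ.real Set.univ : ℝ) • f ((quasiSplit (↥(maximalRealSubfield L)) L (IsCMField.complexConj L) 2).toAdelic (ratCenter (↥(maximalRealSubfield L)) L (IsCMField.complexConj L) 2 ((StdForm.antidiagonal 2).over L) (zrep i))) +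
              ((unfoldingConstant (quasiSplit (↥(maximalRealSubfield L)) L (IsCMField.complexConj L) 2).quotientSubgroup
                  (count : Measure (quasiSplit (↥(maximalRealSubfield L)) L (IsCMField.complexConj L) 2).quotientSubgroup) μ ν : ℝ) : ℂ) *
                (((𝔠 : ℝ) : ℂ) * ((1 : ℂ) *
                  ((1 / 2 : ℂ) * (-(((idelicCovolume (↥(maximalRealSubfield L)) νF).toReal : ℂ) * ((Real.log (borelHeight (1 : (quasiSplit (↥(maximalRealSubfield L)) L (IsCMField.complexConj L) 2).Adelic) : ℝ) : ℝ) : ℂ)) *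
                        (((μA (adeleFundamentalDomain (↥(maximalRealSubfield L)))).toReal⁻¹ : ℂ) * adeleFourier (↥(maximalRealSubfield L)) μA (fun x : AdeleRing (𝓞 (↥(maximalRealSubfield L))) (↥(maximalRealSubfield L)) => ∫ k, f ((k : (quasiSplit (↥(maximalRealSubfield L)) L (IsCMField.complexConj L) 2).Adelic)⁻¹ * (((quasiSplit (↥(maximalRealSubfield L)) L (IsCMField.complexConj L) 2).toAdelic (ratCenter (↥(maximalRealSubfield L)) L (IsCMField.complexConj L) 2 ((StdForm.antidiagonal 2).over L) (zrep i))) * ((middleRootUnipotent hij hN (Multiplicative.ofAdd (traceZeroLine (↥(maximalRealSubfield L)) L (IsCMField.complexConj L) hcδ hδ x)) : adelicUnipotent (↥(maximalRealSubfield L)) L (IsCMField.complexConj L) 2) : (quasiSplit (↥(maximalRealSubfield L)) L (IsCMField.complexConj L) 2).Adelic)) * (k : (quasiSplit (↥(maximalRealSubfield L)) L (IsCMField.complexConj L) 2).Adelic)) ∂μK) 0) +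
                      ((∫ x in {x | 1 ≤ (IdeleClassGroup.ideleNorm (↥(maximalRealSubfield L)) x : ℝ)} ∩ 𝓕F,
                          ideleSum (↥(maximalRealSubfield L)) (fun x : AdeleRing (𝓞 (↥(maximalRealSubfield L))) (↥(maximalRealSubfield L)) => ∫ k, f ((k : (quasiSplit (↥(maximalRealSubfield L)) L (IsCMField.complexConj L) 2).Adelic)⁻¹ * (((quasiSplit (↥(maximalRealSubfield L)) L (IsCMField.complexConj L) 2).toAdelic (ratCenter (↥(maximalRealSubfield L)) L (IsCMField.complexConj L) 2 ((StdForm.antidiagonal 2).over L) (zrep i))) * ((middleRootUnipotent hij hN (Multiplicative.ofAdd (traceZeroLine (↥(maximalRealSubfield L)) L (IsCMField.complexConj L) hcδ hδ x)) : adelicUnipotent (↥(maximalRealSubfield L)) L (IsCMField.complexConj L) 2) : (quasiSplit (↥(maximalRealSubfield L)) L (IsCMField.complexConj L) 2).Adelic)) * (k : (quasiSplit (↥(maximalRealSubfield L)) L (IsCMField.complexConj L) 2).Adelic)) ∂μK) x * ((IdeleClassGroup.ideleNorm (↥(maximalRealSubfield L)) x : ℝ) : ℂ) ∂νF) +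
                        ((μA (adeleFundamentalDomain (↥(maximalRealSubfield L)))).toReal⁻¹ : ℂ) *
                          (∫ x in {x | 1 ≤ (IdeleClassGroup.ideleNorm (↥(maximalRealSubfield L)) x : ℝ)} ∩ 𝓕F,
                            ideleSum (↥(maximalRealSubfield L)) (adeleFourier (↥(maximalRealSubfield L)) μA (fun x : AdeleRing (𝓞 (↥(maximalRealSubfield L))) (↥(maximalRealSubfield L)) => ∫ k, f ((k : (quasiSplit (↥(maximalRealSubfield L)) L (IsCMField.complexConj L) 2).Adelic)⁻¹ * (((quasiSplit (↥(maximalRealSubfield L)) L (IsCMField.complexConj L) 2).toAdelic (ratCenter (↥(maximalRealSubfield L)) L (IsCMField.complexConj L) 2 ((StdForm.antidiagonal 2).over L) (zrep i))) * ((middleRootUnipotent hij hN (Multiplicative.ofAdd (traceZeroLine (↥(maximalRealSubfield L)) L (IsCMField.complexConj L) hcδ hδ x)) : adelicUnipotent (↥(maximalRealSubfield L)) L (IsCMField.complexConj L) 2) : (quasiSplit (↥(maximalRealSubfield L)) L (IsCMField.complexConj L) 2).Adelic)) * (k : (quasiSplit (↥(maximalRealSubfield L)) L (IsCMField.complexConj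 L) 2).Adelic)) ∂μK)) x ∂νF) -
                        ((idelicCovolume (↥(maximalRealSubfield L)) νF).toReal : ℂ) * (fun x : AdeleRing (𝓞 (↥(maximalRealSubfield L))) (↥(maximalRealSubfield L)) => ∫ k, f ((k : (quasiSplit (↥(maximalRealSubfield L)) L (IsCMField.complexConj L) 2).Adelic)⁻¹ * (((quasiSplit (↥(maximalRealSubfield L)) L (IsCMField.complexConj L) 2).toAdelic (ratCenter (↥(maximalRealSubfield L)) L (IsCMField.complexConj L) 2 ((StdForm.antidiagonal 2).over L) (zrep i))) * ((middleRootUnipotent hij hN (Multiplicative.ofAdd (traceZeroLine (↥(maximalRealSubfield L)) L (IsCMField.complexConj L) hcδ hδ x)) : adelicUnipotent (↥(maximalRealSubfield L)) L (IsCMField.complexConj L) 2) : (quasiSplit (↥(maximalRealSubfield L)) L (IsCMField.complexConj L) 2).Adelic)) * (k : (quasiSplit (↥(maximalRealSubfield L)) L (IsCMField.complexConj L) 2).Adelic)) ∂μK) 0)) +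
                    (1 / 2 : ℂ) * ((∫ x in {x | 1 ≤ (IdeleClassGroup.ideleNorm (↥(maximalRealSubfield L)) x : ℝ)} ∩ 𝓕F,
                        ideleSum (↥(maximalRealSubfield L)) (fun x : AdeleRing (𝓞 (↥(maximalRealSubfield L))) (↥(maximalRealSubfield L)) => ∫ k, f ((k : (quasiSplit (↥(maximalRealSubfield L)) L (IsCMField.complexConj L) 2).Adelic)⁻¹ * (((quasiSplit (↥(maximalRealSubfield L)) L (IsCMField.complexConj L) 2).toAdelic (ratCenter (↥(maximalRealSubfield L)) L (IsCMField.complexConj L) 2 ((StdForm.antidiagonal 2).over L) (zrep i))) * ((middleRootUnipotent hij hN (Multiplicative.ofAdd (traceZeroLine (↥(maximalRealSubfield L)) L (IsCMField.complexConj L) hcδ hδ x)) : adelicUnipotent (↥(maximalRealSubfield L)) L (IsCMField.complexConj L) 2) : (quasiSplit (↥(maximalRealSubfield L)) L (IsCMField.complexConj L) 2).Adelic)) * (k : (quasiSplit (↥(maximalRealSubfield L)) L (IsCMField.complexConj L) 2).Adelic)) ∂μK) x * (-1 : ℂ) ^ (quadraticArtinIndicator (↥(maximalRealSubfield L)) ((θ₀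 : 𝓞 (↥(maximalRealSubfield L))) : (↥(maximalRealSubfield L))) x).val *
                          ((IdeleClassGroup.ideleNorm (↥(maximalRealSubfield L)) x : ℝ) : ℂ) ∂νF) +
                      ((μA (adeleFundamentalDomain (↥(maximalRealSubfield L)))).toReal⁻¹ : ℂ) *
                        ∫ x in {x | 1 ≤ (IdeleClassGroup.ideleNorm (↥(maximalRealSubfield L)) x : ℝ)} ∩ 𝓕F,
                          ideleSum (↥(maximalRealSubfield L)) (adeleFourier (↥(maximalRealSubfield L)) μA (fun x : AdeleRing (𝓞 (↥(maximalRealSubfield L))) (↥(maximalRealSubfield L)) => ∫ k, f ((k : (quasiSplit (↥(maximalRealSubfield L)) L (IsCMField.complexConj L) 2).Adelic)⁻¹ * (((quasiSplit (↥(maximalRealSubfield L)) L (IsCMField.complexConj L) 2).toAdelic (ratCenter (↥(maximalRealSubfield L)) L (IsCMField.complexConj L) 2 ((StdForm.antidiagonal 2).over L) (zrep i))) * ((middleRootUnipotent hij hN (Multiplicative.ofAdd (traceZeroLine (↥(maximalRealSubfield L)) L (IsCMField.complexConj L) hcδ hδ x)) : adelicUnipotent (↥(maximalRealSubfield L)) L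 (IsCMField.complexConj L) 2) : (quasiSplit (↥(maximalRealSubfield L)) L (IsCMField.complexConj L) 2).Adelic)) * (k : (quasiSplit (↥(maximalRealSubfield L)) L (IsCMField.complexConj L) 2).Adelic)) ∂μK)) x *
                            (-1 : ℂ) ^ (quadraticArtinIndicator (↥(maximalRealSubfield L)) ((θ₀ : 𝓞 (↥(maximalRealSubfield L))) : (↥(maximalRealSubfield L))) x⁻¹).val ∂νF)))))) +
          (∑ i ∈ ((finite_setOf_borelRefine_charpoly_of_isCompact (F := ↥(maximalRealSubfield L)) (E := L) (c := IsCMField.complexConj L) (N := 2)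
          hf.hasCompactSupport'.isCompact).toFinset).filter (fun i : (AdeleRing (𝓞 L) L)[X] × Bool => i.2 = true ∧
            ∃ a : Lˣ, (IsCMField.complexConj L) (a : L) * (a : L) ≠ 1 ∧
              i.1 = ((X - C (a : L)) * (X - C ((IsCMField.complexConj L) (a : L))⁻¹)).map (algebraMap L (AdeleRing (𝓞 L) L))),
            -(((unfoldingConstant (quasiSplit (↥(maximalRealSubfield L)) L (IsCMField.complexConj L) 2).quotientSubgroup
                (count : Measure (quasiSplit (↥(maximalRealSubfield L)) L (IsCMField.complexConj L) 2).quotientSubgroup) μ ν : ℝ) : ℂ) *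
              (Cw.toReal : ℂ) *
              ∫ x : (quasiSplit (↥(maximalRealSubfield L)) L (IsCMField.complexConj L) 2).Adelic ⧸
                  torusAdelic (↥(maximalRealSubfield L)) L (IsCMField.complexConj L) 2,
                f ((x.out : (quasiSplit (↥(maximalRealSubfield L)) L (IsCMField.complexConj L) 2).Adelic) *
                    (quasiSplit (↥(maximalRealSubfield L)) L (IsCMField.complexConj L) 2).toAdelic (hyrep i) *
                    (x.out : (quasiSplit (↥(maximalRealSubfield L)) L (IsCMField.complexConj L) 2).Adelic)⁻¹) *
                  ((Real.log (borelHeight (x.out : (quasiSplit (↥(maximalRealSubfield L)) L (IsCMField.complexConj L) 2).Adelic)⁻¹) +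
                    Real.log (borelHeight ((quasiSplit (↥(maximalRealSubfield L)) L (IsCMField.complexConj L) 2).toAdelic w *
                      (x.out : (quasiSplit (↥(maximalRealSubfield L)) L (IsCMField.complexConj L) 2).Adelic)⁻¹)) : ℝ) : ℂ)
                ∂(quotientMeasure (torusAdelic (↥(maximalRealSubfield L)) L (IsCMField.complexConj L) 2) ρ isClosed_torusAdelic ν)))) := by
  haveI := t2Space_quasiSplitAdelic (F := ↥(maximalRealSubfield L)) (E := L) (c := IsCMField.complexConj L) (N := 2)
  haveI := locallyCompactSpace_quasiSplitAdelic (F := ↥(maximalRealSubfield L)) (E := L) (c := IsCMField.complexConj L) (N := 2)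
  haveI := secondCountableTopology_quasiSplitAdelic (F := ↥(maximalRealSubfield L)) (E := L) (c := IsCMField.complexConj L) (N := 2)
  haveI : DiscreteTopology (quasiSplit (↥(maximalRealSubfield L)) L (IsCMField.complexConj L) 2).quotientSubgroup := by
    rw [quotientSubgroup_quasiSplit]; exact isDiscreteRational_quasiSplit
  letI := AdelicGroupData.measurableSpaceQuotientForm (quasiSplit (↥(maximalRealSubfield L)) L (IsCMField.complexConj L) 2)
  haveI := AdelicGroupData.borelSpaceQuotientForm (quasiSplit (↥(maximalRealSubfield L)) L (IsCMField.complexConj L) 2)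
  haveI := AdelicGroupData.smulInvariantMeasureQuotientForm (quasiSplit (↥(maximalRealSubfield L)) L (IsCMField.complexConj L) 2) μ
  haveI := AdelicGroupData.isFiniteMeasureOnCompactsQuotientForm (quasiSplit (↥(maximalRealSubfield L)) L (IsCMField.complexConj L) 2) μ
  haveI := t2Space_adeleRing_of_numberField L
  haveI := locallyCompactSpace_adeleRing' L
  haveI := secondCountableTopology_adeleRing L
  have hcl := @exists_const_closerC_central_cm_two' hij hN L _ _ _ instMU instBU instMA instBA instMAF instBAF
    instMI instBI instMAL instBAL ν₀ instν₀ _ h𝓕 μ instμ ν instν _ hβ μB instμB μK instμK μT instμT μN instμN _ hΩ hΩu _ hwT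
    _ hcδ hδ θ₀ hθ hd μA instμA νF instνF _ h𝓕F
  cases hcl with
  | intro 𝔠 h1 =>
    cases h1 with
    | intro h𝔠 closerC =>
      refine ⟨𝔠, h𝔠, fun f hf => ?_⟩
      have h := arthurTrace_eq_orbital_add_central_add_hyperbolic_of_closers_cm_two L ν μ ν₀ 𝓕 h𝓕 rep hrep νC f hf ρ
        hw hC hwin (κc := ratOne (↥(maximalRealSubfield L)) L (IsCMField.complexConj L))
        (fun p : ratOne (↥(maximalRealSubfield L)) L (IsCMField.complexConj L) =>
                ((μ.real Set.univ : ℝ) • f ((quasiSplit (↥(maximalRealSubfield L)) L (IsCMField.complexConj L) 2).toAdelic (ratCenter (↥(maximalRealSubfield L)) L (IsCMField.complexConj L) 2 ((StdForm.antidiagonal 2).over L) p)) +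
                  ((unfoldingConstant (quasiSplit (↥(maximalRealSubfield L)) L (IsCMField.complexConj L) 2).quotientSubgroup
                      (count : Measure (quasiSplit (↥(maximalRealSubfield L)) L (IsCMField.complexConj L) 2).quotientSubgroup) μ ν : ℝ) : ℂ) *
                    (((𝔠 : ℝ) : ℂ) * ((1 : ℂ) *
                      ((1 / 2 : ℂ) * (-(((idelicCovolume (↥(maximalRealSubfield L)) νF).toReal : ℂ) * ((Real.log (borelHeight (1 : (quasiSplit (↥(maximalRealSubfield L)) L (IsCMField.complexConj L) 2).Adelic) : ℝ) : ℝ) : ℂ)) *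
                            (((μA (adeleFundamentalDomain (↥(maximalRealSubfield L)))).toReal⁻¹ : ℂ) * adeleFourier (↥(maximalRealSubfield L)) μA (fun x : AdeleRing (𝓞 (↥(maximalRealSubfield L))) (↥(maximalRealSubfield L)) => ∫ k, f ((k : (quasiSplit (↥(maximalRealSubfield L)) L (IsCMField.complexConj L) 2).Adelic)⁻¹ * (((quasiSplit (↥(maximalRealSubfield L)) L (IsCMField.complexConj L) 2).toAdelic (ratCenter (↥(maximalRealSubfield L)) L (IsCMField.complexConj L) 2 ((StdForm.antidiagonal 2).over L) p)) * ((middleRootUnipotent hij hN (Multiplicative.ofAdd (traceZeroLine (↥(maximalRealSubfield L)) L (IsCMField.complexConj L) hcδ hδ x)) : adelicUnipotent (↥(maximalRealSubfield L)) L (IsCMField.complexConj L) 2) : (quasiSplit (↥(maximalRealSubfield L)) L (IsCMField.complexConj L) 2).Adelic)) * (k : (quasiSplit (↥(maximalRealSubfield L)) L (IsCMField.complexConj L) 2).Adelic)) ∂μK) 0) +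
                          ((∫ x in {x | 1 ≤ (IdeleClassGroup.ideleNorm (↥(maximalRealSubfield L)) x : ℝ)} ∩ 𝓕F,
                              ideleSum (↥(maximalRealSubfield L)) (fun x : AdeleRing (𝓞 (↥(maximalRealSubfield L))) (↥(maximalRealSubfield L)) => ∫ k, f ((k : (quasiSplit (↥(maximalRealSubfield L)) L (IsCMField.complexConj L) 2).Adelic)⁻¹ * (((quasiSplit (↥(maximalRealSubfield L)) L (IsCMField.complexConj L) 2).toAdelic (ratCenter (↥(maximalRealSubfield L)) L (IsCMField.complexConj L) 2 ((StdForm.antidiagonal 2).over L) p)) * ((middleRootUnipotent hij hN (Multiplicative.ofAdd (traceZeroLine (↥(maximalRealSubfield L)) L (IsCMField.complexConj L) hcδ hδ x)) : adelicUnipotent (↥(maximalRealSubfield L)) L (IsCMField.complexConj L) 2) : (quasiSplit (↥(maximalRealSubfield L)) L (IsCMField.complexConj L) 2).Adelic)) * (k : (quasiSplit (↥(maximalRealSubfield L)) L (IsCMField.complexConj L) 2).Adelic)) ∂μK) x * ((IdeleClassGroup.ideleNorm (↥(maximalRealSubfield L)) x : ℝ) : ℂ) ∂νF) +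
                            ((μA (adeleFundamentalDomain (↥(maximalRealSubfield L)))).toReal⁻¹ : ℂ) *
                              (∫ x in {x | 1 ≤ (IdeleClassGroup.ideleNorm (↥(maximalRealSubfield L)) x : ℝ)} ∩ 𝓕F,
                                ideleSum (↥(maximalRealSubfield L)) (adeleFourier (↥(maximalRealSubfield L)) μA (fun x : AdeleRing (𝓞 (↥(maximalRealSubfield L))) (↥(maximalRealSubfield L)) => ∫ k, f ((k : (quasiSplit (↥(maximalRealSubfield L)) L (IsCMField.complexConj L) 2).Adelic)⁻¹ * (((quasiSplit (↥(maximalRealSubfield L)) L (IsCMField.complexConj L) 2).toAdelic (ratCenter (↥(maximalRealSubfield L)) L (IsCMField.complexConj L) 2 ((StdForm.antidiagonal 2).over L) p)) * ((middleRootUnipotent hij hN (Multiplicative.ofAdd (traceZeroLine (↥(maximalRealSubfield L)) L (IsCMField.complexConj L) hcδ hδ x)) : adelicUnipotent (↥(maximalRealSubfield L)) L (IsCMField.complexConj L) 2) : (quasiSplit (↥(maximalRealSubfield L)) L (IsCMField.complexConj L) 2).Adelic)) * (k : (quasiSplit (↥(maximalRealSubfield L)) L (IsCMField.complexConj L) 2).Adelic))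 ∂μK)) x ∂νF) -
                            ((idelicCovolume (↥(maximalRealSubfield L)) νF).toReal : ℂ) * (fun x : AdeleRing (𝓞 (↥(maximalRealSubfield L))) (↥(maximalRealSubfield L)) => ∫ k, f ((k : (quasiSplit (↥(maximalRealSubfield L)) L (IsCMField.complexConj L) 2).Adelic)⁻¹ * (((quasiSplit (↥(maximalRealSubfield L)) L (IsCMField.complexConj L) 2).toAdelic (ratCenter (↥(maximalRealSubfield L)) L (IsCMField.complexConj L) 2 ((StdForm.antidiagonal 2).over L) p)) * ((middleRootUnipotent hij hN (Multiplicative.ofAdd (traceZeroLine (↥(maximalRealSubfield L)) L (IsCMField.complexConj L) hcδ hδ x)) : adelicUnipotent (↥(maximalRealSubfield L)) L (IsCMField.complexConj L) 2) : (quasiSplit (↥(maximalRealSubfield L)) L (IsCMField.complexConj L) 2).Adelic)) * (k : (quasiSplit (↥(maximalRealSubfield L)) L (IsCMField.complexConj L) 2).Adelic)) ∂μK) 0)) +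
                        (1 / 2 : ℂ) * ((∫ x in {x | 1 ≤ (IdeleClassGroup.ideleNorm (↥(maximalRealSubfield L)) x : ℝ)} ∩ 𝓕F,
                            ideleSum (↥(maximalRealSubfield L)) (fun x : AdeleRing (𝓞 (↥(maximalRealSubfield L))) (↥(maximalRealSubfield L)) => ∫ k, f ((k : (quasiSplit (↥(maximalRealSubfield L)) L (IsCMField.complexConj L) 2).Adelic)⁻¹ * (((quasiSplit (↥(maximalRealSubfield L)) L (IsCMField.complexConj L) 2).toAdelic (ratCenter (↥(maximalRealSubfield L)) L (IsCMField.complexConj L) 2 ((StdForm.antidiagonal 2).over L) p)) * ((middleRootUnipotent hij hN (Multiplicative.ofAdd (traceZeroLine (↥(maximalRealSubfield L)) L (IsCMField.complexConj L) hcδ hδ x)) : adelicUnipotent (↥(maximalRealSubfield L)) L (IsCMField.complexConj L) 2) : (quasiSplit (↥(maximalRealSubfield L)) L (IsCMField.complexConj L) 2).Adelic)) * (k : (quasiSplit (↥(maximalRealSubfield L)) L (IsCMField.complexConj L) 2).Adelic)) ∂μK) x * (-1 : ℂ) ^ (quadraticArtinIndicator (↥(maximalRealSubfield L)) ((θ₀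 : 𝓞 (↥(maximalRealSubfield L))) : (↥(maximalRealSubfield L))) x).val *
                              ((IdeleClassGroup.ideleNorm (↥(maximalRealSubfield L)) x : ℝ) : ℂ) ∂νF) +
                          ((μA (adeleFundamentalDomain (↥(maximalRealSubfield L)))).toReal⁻¹ : ℂ) *
                            ∫ x in {x | 1 ≤ (IdeleClassGroup.ideleNorm (↥(maximalRealSubfield L)) x : ℝ)} ∩ 𝓕F,
                              ideleSum (↥(maximalRealSubfield L)) (adeleFourier (↥(maximalRealSubfield L)) μA (fun x : AdeleRing (𝓞 (↥(maximalRealSubfield L))) (↥(maximalRealSubfield L)) => ∫ k, f ((k : (quasiSplit (↥(maximalRealSubfield L)) L (IsCMField.complexConj L) 2).Adelic)⁻¹ * (((quasiSplit (↥(maximalRealSubfield L)) L (IsCMField.complexConj L) 2).toAdelic (ratCenter (↥(maximalRealSubfield L)) L (IsCMField.complexConj L) 2 ((StdForm.antidiagonal 2).over L) p)) * ((middleRootUnipotent hij hN (Multiplicative.ofAdd (traceZeroLine (↥(maximalRealSubfield L)) L (IsCMField.complexConj L) hcδ hδ x)) : adelicUnipotent (↥(maximalRealSubfield L)) L (IsCMField.complexConj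 L) 2) : (quasiSplit (↥(maximalRealSubfield L)) L (IsCMField.complexConj L) 2).Adelic)) * (k : (quasiSplit (↥(maximalRealSubfield L)) L (IsCMField.complexConj L) 2).Adelic)) ∂μK)) x *
                                (-1 : ℂ) ^ (quadraticArtinIndicator (↥(maximalRealSubfield L)) ((θ₀ : 𝓞 (↥(maximalRealSubfield L))) : (↥(maximalRealSubfield L))) x⁻¹).val ∂νF))))))
        (closerC hf)
      cases h with
      | intro zrep h2 =>
        cases h2 with
        | intro hyrep hJ => exact ⟨zrep, hyrep, hJ⟩

end UnitaryGroup

end Literature.NumberTheory.Automorphic
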